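import Summits.BirchSwinnertonDyer.BirchSwinnertonDyer.Theorems.ManinLocalTwoThreeManinPrimeToAdditiveFiveLeGloballyTwistMinimal
import Summits.BirchSwinnertonDyer.Rank1Residual.Additive.GordKodairaType
import Literature.NumberTheory.EllipticCurves.ManinConstantKodairaTypePrimes
import Literature.NumberTheory.EllipticCurves.ManinConstantNonPotentiallyOrdinaryPrimes
import HarnessLib

/-!
# Route `ManinLocalTwoThree`, residual crux C5 `ManinPrimeToAdditiveFiveLe` (stmt-BirchSwinnertonDyer-22969):
# **the EDIXHOVEN REDUCTION — C5 ⟸ Edixhoven 1991 Thm. 3 (two cite-only tree facts) + its two open cores**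

CONDITIONAL reduction (a `--supports` helper; C5 is NOT proved here). The residual conjunct C5 of
the route says: for every globally minimal `W/ℚ` with a lattice-optimal `X₀(N)`-datum `D`, every
prime `p ≥ 5` with `p² ∣ N` has `p ∤ c(D)`, granted the route's four printed facts. This file
records, kernel-checked, how far PRINT reaches inside C5 and names what is left, with no twist-orbit
machinery: granted Edixhoven 1991 Thm. 3 in the tree's two statement-only transcriptions
(`edixhoven_not_dvd_maninConstant_of_kodairaSymbol_ne`: `p > 7`, Kodaira symbol at `p` not II, III,
IV ⇒ `p ∤ c`; `edixhoven_not_dvd_maninConstant_of_not_potentiallyGoodOrdinary`: `p > 7`, `E` not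
potentially good ordinary at `p` in the (G)-shape ⇒ `p ∤ c`), C5 FOLLOWS from its restriction to
the two cores
* (57) `p ∈ {5, 7}` (Raynaud's `e < p − 1` fails for `e ∈ {4, 6}`; nothing in print), and
* (11) `p > 7`, `ord_p Δ_min(W) ≤ 4` (Kodaira II, III or IV at `p`) AND `W` potentially good
  ordinary at `p` in the (G)-shape — verbatim Edixhoven's printed exception («in that case `p`
  divides `c` at most once»; `p ∤ c` there is asserted only in the unpublished thesis [Edi89],
  cf. Agashe–Ribet–Stein 2006 §2),
both cores moreover restricted to the GLOBALLY TWIST-MINIMAL classes of the route helper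
`maninLocalTwoThree_maninPrimeToAdditiveFiveLe_of_globallyTwistMinimal` (p587193: no odd
semistable `χ_{q*}`-untwist, no dyadic semistable untwist) and to conductor-level data.

Proof: the frame p587193; `N = N(W)` by `IsNewformOf.level_eq_conductorNorm_of_exists_isNewformOf`;
split `p ∈ {5,7}` / `p > 7` (a prime `≥ 5` other than `5, 7` exceeds `7`); at `p > 7` split on
`ord_p Δ_min ≤ 4`, which at an additive `p ≥ 5` is EQUIVALENT to Kodaira type II/III/IV
(`Additive.kodairaSymbolAt_placeOf_II_or_III_or_IV_iff_of_addv`, Tate's algorithm / *ATAEC*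
Table 4.1; additivity from `p² ∣ N`, `ManinAdditive.not_good_and_not_mult_of_sq_dvd_conductorNorm`):
the starred side is the Kodaira fact, the unstarred side splits on the (G)-ordinary clause into the
non-potentially-ordinary fact and core (11).

HONEST SCOPE. Conditional on two unproved named facts (the gate records `conditional-result`);
closes nothing; the cores (57) and (11) are exactly the open content of Manin's conjecture at an
additive prime `p ≥ 5` as known in print. Data point (cell census TWISTCENSUS2, HOME
`data/TWISTCENSUS2-rows-v1.tsv.gz`): core (11) is met in Cremona's range also by `W[p]`-REDUCIBLE
classes at `p = 13` (e.g. `216320i1`, type II at `13`, `j ≡ 0 (mod 13)` ordinary), besides the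
irreducible ones. BSD is not proved by this; C5 is not proved by this. Seat bsd-line-ml23-c5-p1 (lead).

References: [EdixhovenManin1991] Thm. 3; [AgasheRibetStein2006] §2 (Thms. 2.2–2.7 and the remark
on [Edi89]); [SilvermanATAEC1994] IV Table 4.1; [Stevens1989] (5.2), (5.4) (the frame).
-/

set_option autoImplicit false
set_option linter.dupNamespace false

noncomputable section

open scoped Classical NumberField

namespace Summit.BirchSwinnertonDyer.BirchSwinnertonDyer.Theorems

open WeierstrassCurve IsDedekindDomain IsDedekindDomain.HeightOneSpectrum Rat.HeightOneSpectrum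
  NumberField
  Literature.NumberTheory.EllipticCurves Literature.NumberTheory.EllipticCurves.ModularForms
  Literature.NumberTheory.EllipticCurves.Rank1Residual
  Summit.BirchSwinnertonDyer.Rank1Residual.Additive

/-- **EDIXHOVEN REDUCTION of C5 (conditional).** Granted Edixhoven 1991 Thm. 3 in the tree's two
statement-only forms (`hK`: Kodaira symbol at `p > 7` not II/III/IV ⇒ `p ∤ c`; `hG`: not potentially
good ordinary at `p > 7` ⇒ `p ∤ c`), crux C5 `ManinLocalTwoThree.ManinPrimeToAdditiveFiveLe` follows
from its restriction to (57) `p ∈ {5,7}` and (11) `p > 7`, `ord_p Δ_min ≤ 4`, potentially good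
ordinary in the (G)-shape — both on globally twist-minimal classes (no odd `χ_{q*}` semistable
untwist, no dyadic semistable untwist) with conductor-level lattice-optimal data. C5 itself is NOT
proved; (57) and (11) are its open cores in print. [cite: EdixhovenManin1991, Thm. 3]
[cite: AgasheRibetStein2006, §2] [cite: SilvermanATAEC1994, IV Table 4.1] -/
theorem maninLocalTwoThree_maninPrimeToAdditiveFiveLe_of_edixhoven_of_cores
    (hK : edixhoven_not_dvd_maninConstant_of_kodairaSymbol_ne)
    (hG : edixhoven_not_dvd_maninConstant_of_not_potentiallyGoodOrdinary)
    (h57 : ∀ (W : WeierstrassCurve ℚ) [W.IsElliptic] [W.IsGloballyMinimal]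
      [NeZero (W.conductorNorm ℤ)] (D : ModularParametrizationData W (W.conductorNorm ℤ)),
      (∀ z ∈ D.L.lattice, ∃ w ∈ periodLattice D.f, z = D.c * w) →
      ∀ p : ℕ, p.Prime → (p = 5 ∨ p = 7) → p ^ 2 ∣ W.conductorNorm ℤ →
      ¬ (∃ (W' : WeierstrassCurve ℚ) (q : ℕ), W'.IsElliptic ∧ W'.IsGloballyMinimal ∧
          q.Prime ∧ q ≠ 2 ∧ q ^ 2 ∣ W.conductorNorm ℤ ∧
          IsIsogenous W (W'.quadraticTwist (((-1 : ℤ) ^ (q / 2) * q : ℤ) : ℚ)) ∧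
          ¬ q ^ 2 ∣ W'.conductorNorm ℤ) →
      ¬ (∃ (W' : WeierstrassCurve ℚ) (d : ℤ), W'.IsElliptic ∧ W'.IsGloballyMinimal ∧
          (d = -1 ∨ d = 2 ∨ d = -2) ∧ 2 ^ 2 ∣ W.conductorNorm ℤ ∧
          IsIsogenous W (W'.quadraticTwist (d : ℚ)) ∧ ¬ 2 ^ 2 ∣ W'.conductorNorm ℤ) →
      ¬ (p : ℤ) ∣ D.maninConstant)
    (h11 : ∀ (W : WeierstrassCurve ℚ) [W.IsElliptic] [W.IsGloballyMinimal]
      [NeZero (W.conductorNorm ℤ)] (D : ModularParametrizationData W (W.conductorNorm ℤ)),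
      (∀ z ∈ D.L.lattice, ∃ w ∈ periodLattice D.f, z = D.c * w) →
      ∀ (p : ℕ), p.Prime → 7 < p → p ^ 2 ∣ W.conductorNorm ℤ →
      ¬ (∃ (W' : WeierstrassCurve ℚ) (q : ℕ), W'.IsElliptic ∧ W'.IsGloballyMinimal ∧
          q.Prime ∧ q ≠ 2 ∧ q ^ 2 ∣ W.conductorNorm ℤ ∧
          IsIsogenous W (W'.quadraticTwist (((-1 : ℤ) ^ (q / 2) * q : ℤ) : ℚ)) ∧
          ¬ q ^ 2 ∣ W'.conductorNorm ℤ) →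
      ¬ (∃ (W' : WeierstrassCurve ℚ) (d : ℤ), W'.IsElliptic ∧ W'.IsGloballyMinimal ∧
          (d = -1 ∨ d = 2 ∨ d = -2) ∧ 2 ^ 2 ∣ W.conductorNorm ℤ ∧
          IsIsogenous W (W'.quadraticTwist (d : ℚ)) ∧ ¬ 2 ^ 2 ∣ W'.conductorNorm ℤ) →
      padicValInt p W.minimalDiscriminantInt ≤ 4 →
      (∃ (L : Type) (_ : Field L) (_ : NumberField L) (_ : IsCyclotomicExtension {p} ℚ L)
          (F : IntermediateField ℚ L),
          ∀ w : HeightOneSpectrum (𝓞 F), (p : 𝓞 F) ∈ w.asIdeal →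
            (W.baseChange F).HasGoodReductionAt w ∧ (W.baseChange F).HasUnitRootAt w) →
      ¬ (p : ℤ) ∣ D.maninConstant) :
    Summit.BirchSwinnertonDyer.BirchSwinnertonDyer.Theses.ManinLocalTwoThree.ManinPrimeToAdditiveFiveLe := by
  refine maninLocalTwoThree_maninPrimeToAdditiveFiveLe_of_globallyTwistMinimal ?_
  intro hM hAU hC hnf W hE hGM N hN0 D hopt p hp h5 hpN hodd hdy
  haveI hpF : Fact p.Prime := ⟨hp⟩
  have hN : N = W.conductorNorm ℤ :=
    IsNewformOf.level_eq_conductorNorm_of_exists_isNewformOf hnf D.isNewformOf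
  subst hN
  by_cases h57p : p = 5 ∨ p = 7
  · exact h57 W D hopt p hp h57p hpN hodd hdy
  · -- a prime `p ≥ 5` other than `5, 7` exceeds `7`
    have h7 : 7 < p := by
      obtain ⟨hp5, hp7⟩ := not_or.mp h57p
      have hp6 : p ≠ 6 := by rintro rfl; norm_num at hp
      omega
    -- `W` is additive at `p`
    have hadd : Addv W p :=
      Summit.BirchSwinnertonDyer.Rank1Residual.ManinAdditive.not_good_and_not_mult_of_sq_dvd_conductorNorm
        W hpN
    by_cases hlow : padicValInt p W.minimalDiscriminantInt ≤ 4
    · -- unstarred (Kodaira II / III / IV): split on the (G)-ordinary clause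
      by_cases hGo : ∃ (L : Type) (_ : Field L) (_ : NumberField L)
          (_ : IsCyclotomicExtension {p} ℚ L) (F : IntermediateField ℚ L),
          ∀ w : HeightOneSpectrum (𝓞 F), (p : 𝓞 F) ∈ w.asIdeal →
            (W.baseChange F).HasGoodReductionAt w ∧ (W.baseChange F).HasUnitRootAt w
      · exact h11 W D hopt p hp h7 hpN hodd hdy hlow hGo
      · exact hG W D hopt p hp h7 hGo
    · -- starred (Kodaira I₀*/Iₙ*/IV*/III*/II*, here `ord_p Δ_min > 4`): the Kodaira-type fact
      have hnot : ¬ (W.kodairaSymbolAt (placeOf p) = .II ∨ W.kodairaSymbolAt (placeOf p) = .III ∨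
          W.kodairaSymbolAt (placeOf p) = .IV) :=
        fun h ↦ hlow ((kodairaSymbolAt_placeOf_II_or_III_or_IV_iff_of_addv W p h5 hadd).mp h)
      have h2 : W.kodairaSymbolAt (placeOf p) ≠ .II := fun h ↦ hnot (Or.inl h)
      have h3 : W.kodairaSymbolAt (placeOf p) ≠ .III := fun h ↦ hnot (Or.inr (Or.inl h))
      have h4 : W.kodairaSymbolAt (placeOf p) ≠ .IV := fun h ↦ hnot (Or.inr (Or.inr h))
      exact hK W D hopt p hp h7 h2 h3 h4

end Summit.BirchSwinnertonDyer.BirchSwinnertonDyer.Theorems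

end
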